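import Literature.NumberTheory.GaloisRepresentations.LocalKummerIota
import Literature.NumberTheory.GaloisRepresentations.DualityLineTwo
import HarnessLib

/-!
# `H²(S, μ_n[p]) → H²(S, μ_n)` is injective (Kummer theory)

For a field `k` of characteristic `0`, a closed subgroup `S ≤ Γ_k` with `H¹(S, K̄ˣ) = 0` (e.g.
`S = Gal(K̄/E)`, Hilbert 90) and `p ∣ n`, the map `H²(S, μ_n[p]) → H²(S, μ_n)` induced by the
inclusion of the `p`-torsion `μ_n[p] = μ_p` is injective
(`cohomologyMap_torsionIncl_mu_injective`): through the identification `μ_n[p] ≅ μ_p`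
(`muTorsionIso`) and the inclusion `μ_p ⊆ μ_n` (`muInclHom`), the composite
`H²(S, μ_p) → H²(S, μ_n) → H²(S, K̄ˣ)` is the Kummer map of `μ_p`, injective
(`kummerTwo_injective`).  Together with `exists_injective_iota` this supplies hypothesis `(0, 2)`
of the local duality dévissage (`zeroTwo_eq_zero_of_torsionIncl_injective`) for the module `μ_n`
over `Gal(K̄/E)` (`zeroTwo_eq_zero_galFixing`).

## References
* J.-P. Serre, *Galois Cohomology*, Springer, 1997, II §1.2 and II §5.2. [SerreGaloisCohomology1997]
-/

noncomputable section

open CategoryTheory Function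
open Field IsNonarchimedeanLocalField ValuativeRel IntermediateField

universe u

namespace Literature.NumberTheory.GaloisRepresentations

open _root_.TopRep _root_.ContRepresentation _root_.ContinuousCohomology DiscreteGaloisModule
open LocalWeilDatum

/-! ### `μ_p ⊆ μ_n` and `μ_n[p] ≅ μ_p` -/

section MuIncl

variable (k : Type u) [Field k] {p n : ℕ}

/-- A unit of `K̄` with `u ^ n = 1` as an element of the carrier of `μ_n`. [folklore] -/
def muOfUnit (n : ℕ) (u : (AlgebraicClosure k)ˣ) (hu : u ^ n = 1) : MuCarrier k n :=
  MuCarrier.ofRootsOfUnity ⟨u, (mem_rootsOfUnity _ _).2 hu⟩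

/-- `muVal (muOfUnit u) = u`. [folklore] -/
@[simp] theorem muVal_muOfUnit (n : ℕ) (u : (AlgebraicClosure k)ˣ) (hu : u ^ n = 1) :
    muVal k n (muOfUnit k n u hu) = u := rfl

/-- `muOfUnit (muVal v) = v`. [folklore] -/
@[simp] theorem muOfUnit_muVal (n : ℕ) (v : MuCarrier k n) (h : muVal k n v ^ n = 1) :
    muOfUnit k n (muVal k n v) h = v := rfl

variable (hpn : p ∣ n)

include hpn in
/-- `(muVal v)^n = 1` for `v ∈ μ_p`, `p ∣ n`. [folklore] -/
theorem muVal_pow_eq_one_of_dvd (v : MuCarrier k p) : muVal k p v ^ n = 1 := by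
  obtain ⟨c, rfl⟩ := hpn
  rw [pow_mul, muVal_pow_eq_one, one_pow]

/-- **The inclusion `μ_p → μ_n`** for `p ∣ n`, on carriers. [folklore] -/
def muInclusion : MuCarrier k p →+ MuCarrier k n where
  toFun v := muOfUnit k n (muVal k p v) (muVal_pow_eq_one_of_dvd k hpn v)
  map_zero' := muVal_injective k n (by rw [muVal_muOfUnit, muVal_zero, muVal_zero])
  map_add' v w := muVal_injective k n (by rw [muVal_muOfUnit, muVal_add, muVal_add, muVal_muOfUnit, muVal_muOfUnit])

/-- `muVal ∘ muInclusion = muVal`. [folklore] -/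
@[simp] theorem muVal_muInclusion (v : MuCarrier k p) : muVal k n (muInclusion k hpn v) = muVal k p v := rfl

/-- **The inclusion `μ_p → μ_n` as a morphism of discrete `Γ_k`-modules.** [folklore] -/
def muInclHom : (mu k p).toTopRep ⟶ (mu k n).toTopRep :=
  TopRep.ofHom ⟨⟨(muInclusion k hpn).toIntLinearMap, continuous_of_discreteTopology⟩, fun σ => by
    ext v
    apply muVal_injective k n
    change muVal k n (muInclusion k hpn (mu k p σ v)) = muVal k n (mu k n σ (muInclusion k hpn v))
    rw [muVal_muInclusion, muVal_apply, muVal_apply, muVal_muInclusion]⟩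

/-- `muInclHom` on elements. [folklore] -/
@[simp] theorem muInclHom_hom_apply (v : MuCarrier k p) : (muInclHom k hpn).hom v = muInclusion k hpn v := rfl

/-- **`kummerι_p = kummerι_n ∘ (μ_p ⊆ μ_n)` on elements.** [folklore] -/
theorem kummerι_eq_kummerι_muInclHom (v : MuCarrier k p) :
    (kummerι k p).hom v = (kummerι k n).hom ((muInclHom k hpn).hom v) := rfl

variable (S : Subgroup (absoluteGaloisGroup k)) (p)

/-- **`μ_n[p] ≃ μ_p`** (as `ℤ`-modules with the discrete topology): an `n`-th root of unity killed by
`p` is a `p`-th root of unity. [folklore] -/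
def muTorsionEquiv : Submodule.torsionBy ℤ (MuCarrier k n) (p : ℤ) ≃L[ℤ] MuCarrier k p :=
  let e : Submodule.torsionBy ℤ (MuCarrier k n) (p : ℤ) ≃+ MuCarrier k p :=
    { toFun := fun x => muOfUnit k p (muVal k n (x : MuCarrier k n)) (by
        rw [← muVal_nsmul, (ContinuousRep.mem_torsionBy_nsmul_iff p).1 x.2, muVal_zero])
      invFun := fun v => ⟨muInclusion k hpn v, by
        rw [ContinuousRep.mem_torsionBy_nsmul_iff, ← map_nsmul]
        have h : p • v = 0 := muVal_injective k p (by rw [muVal_nsmul, muVal_pow_eq_one, muVal_zero])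
        rw [h, map_zero]⟩
      left_inv := fun x => Subtype.ext rfl
      right_inv := fun v => rfl
      map_add' := fun x y => muVal_injective k p (by
        rw [muVal_add, muVal_muOfUnit, muVal_muOfUnit, muVal_muOfUnit]
        exact muVal_add k n _ _) }
  { e.toIntLinearEquiv with
    continuous_toFun := continuous_of_discreteTopology
    continuous_invFun := continuous_of_discreteTopology }

/-- `muVal ∘ muTorsionEquiv = muVal`. [folklore] -/
@[simp] theorem muVal_muTorsionEquiv (x : Submodule.torsionBy ℤ (MuCarrier k n) (p : ℤ)) :
    muVal k p (muTorsionEquiv k p hpn x) = muVal k n (x : MuCarrier k n) := rfl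

/-- **`μ_n[p] ≅ μ_p` as topological representations of a subgroup `S ≤ Γ_k`.** [folklore] -/
def muTorsionIso :
    ((((mu k n).restrict (subgroupIncl S))).torsionRep p).toTopRep ≅
      ((mu k p).restrict (subgroupIncl S)).toTopRep :=
  topRepIsoOfEquiv (X := ((((mu k n).restrict (subgroupIncl S))).torsionRep p).toTopRep)
    (Y := ((mu k p).restrict (subgroupIncl S)).toTopRep) (muTorsionEquiv k p hpn) fun g x => by
    apply muVal_injective k p
    change muVal k p (muTorsionEquiv k p hpn ((((mu k n).restrict (subgroupIncl S))).torsionRep p g x)) =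
      muVal k p ((mu k p).restrict (subgroupIncl S) g (muTorsionEquiv k p hpn x))
    rw [muVal_muTorsionEquiv, ContinuousRep.subrepresentation_apply_coe, ContinuousRep.restrict_apply,
      ContinuousRep.restrict_apply, subgroupIncl_apply, muVal_apply, muVal_apply, muVal_muTorsionEquiv]

/-- **The inclusion `μ_n[p] ⊆ μ_n` factors through `μ_n[p] ≅ μ_p ⊆ μ_n`** (on elements). [folklore] -/
theorem torsionIncl_eq_muInclHom_muTorsionIso (x : Submodule.torsionBy ℤ (MuCarrier k n) (p : ℤ)) :
    (((mu k n).restrict (subgroupIncl S)).torsionIncl p).hom x =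
      (resModHom S (muInclHom k hpn)).hom ((muTorsionIso k p hpn S).hom.hom x) := rfl

end MuIncl

/-! ### Injectivity -/

section Injective

variable (k : Type u) [Field k] [CharZero k] (S : Subgroup (absoluteGaloisGroup k))
  [hS : IsClosed (S : Set (absoluteGaloisGroup k))]

attribute [local instance] compactSpace_of_isClosed_subgroup

/-- **`H²(S, μ_p) → H²(S, μ_n)` is injective** (`p ∣ n`, `H¹(S, K̄ˣ) = 0`): its composite with the
Kummer map of `μ_n` is the Kummer map of `μ_p`. [cite: SerreGaloisCohomology1997, II §1.2] -/
theorem cohomologyMap_muInclHom_injective {p n : ℕ} (hpn : p ∣ n) (hp : 0 < p)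
    (h90 : Subsingleton (continuousCohomology 1 ((units k).restrict (subgroupIncl S)).toTopRep)) :
    Injective (cohomologyMap (resModHom S (muInclHom k hpn)) 2) := by
  have hfac : ∀ y, kummerTwo k S p y =
      kummerTwo k S n (cohomologyMap (resModHom S (muInclHom k hpn)) 2 y) := fun y =>
    map_comp_apply_of (ContinuousMonoidHom.id S) (ContinuousMonoidHom.id S) (ContinuousMonoidHom.id S)
      (fun _ => rfl) (resIdHom (resModHom S (muInclHom k hpn))) (resIdHom (resModHom S (kummerι k n)))
      (resIdHom (resModHom S (kummerι k p))) (fun _ => rfl) 2 y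
  intro y y' h
  apply kummerTwo_injective k S hp h90
  rw [hfac, hfac, h]

/-- **`H²(S, μ_n[p]) → H²(S, μ_n)` is injective** (`p ∣ n`, `H¹(S, K̄ˣ) = 0`).
[cite: SerreGaloisCohomology1997, II §1.2] -/
theorem cohomologyMap_torsionIncl_mu_injective {p n : ℕ} (hpn : p ∣ n) (hp : 0 < p)
    (h90 : Subsingleton (continuousCohomology 1 ((units k).restrict (subgroupIncl S)).toTopRep)) :
    Injective (cohomologyMap (((mu k n).restrict (subgroupIncl S)).torsionIncl p) 2) := by
  let e := muTorsionIso k p hpn S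
  have hfac : ∀ z, cohomologyMap (((mu k n).restrict (subgroupIncl S)).torsionIncl p) 2 z =
      cohomologyMap (resModHom S (muInclHom k hpn)) 2 (cohomologyMap e.hom 2 z) := fun z =>
    map_comp_apply_of (ContinuousMonoidHom.id S) (ContinuousMonoidHom.id S) (ContinuousMonoidHom.id S)
      (fun _ => rfl) (resIdHom e.hom) (resIdHom (resModHom S (muInclHom k hpn)))
      (resIdHom (((mu k n).restrict (subgroupIncl S)).torsionIncl p)) (fun _ => rfl) 2 z
  have he : Injective (cohomologyMap e.hom 2) := fun z z' h => by
    rw [← cohomologyMap_inv_hom_apply e 2 z, ← cohomologyMap_inv_hom_apply e 2 z']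
    exact congrArg _ h
  intro z z' h
  rw [hfac, hfac] at h
  exact he (cohomologyMap_muInclHom_injective k S hpn hp h90 h)

end Injective

/-! ### Hypothesis `(0, 2)` for `μ_n` over `Gal(K̄/E)` -/

section GalFixing

variable (k : Type u) [Field k] [CharZero k] (E : IntermediateField k (AlgebraicClosure k))

attribute [local instance] compactSpace_of_isClosed_subgroup

omit [CharZero k] in
/-- `Gal(K̄/E)` is closed (instance form). [folklore] -/
theorem isClosed_galFixing_inst :
    IsClosed ((galFixing k E : Subgroup (absoluteGaloisGroup k)) : Set (absoluteGaloisGroup k)) :=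
  isClosed_galFixing k E

attribute [local instance] isClosed_galFixing_inst

/-- **Hypothesis `(0, 2)` of the local duality dévissage over `Gal(K̄/E)` for `Ω = μ_n`** (any field
`k` of characteristic `0`, any `E ⊆ K̄`): for every prime `p ∣ n`, every `W` of order `p` with trivial
action and every injective `ι : H²(Gal(K̄/E), μ_n) → ℤ/n`, a class `z ∈ H²(Gal(K̄/E), Hom(W, μ_n))`
with `ι(H²(⟨w, ·⟩) z) = 0` for all `w` vanishes (`zeroTwo_eq_zero_of_torsionIncl_injective` with the
Kummer injectivity `cohomologyMap_torsionIncl_mu_injective` and Hilbert 90).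
[cite: SerreGaloisCohomology1997, II §5.2 Thm. 2 (proof)] -/
theorem zeroTwo_eq_zero_galFixing {n : ℕ} {p : ℕ} [hp : Fact p.Prime] (hpn : p ∣ n)
    (ι : continuousCohomology 2 ((mu k n).restrict (subgroupIncl (galFixing k E))).toTopRep →+ ZMod n)
    (hι : Injective ι) {W : Type u} [AddCommGroup W] [TopologicalSpace W] [DiscreteTopology W]
    [Finite W] (τ : ContinuousRep (galFixing k E) ℤ W) (hτ : ∀ (g : galFixing k E) (w : W), τ g w = w)
    (hW : Nat.card W = p) (z : continuousCohomology 2 (τ.homRep ((mu k n).restrict (subgroupIncl (galFixing k E)))).toTopRep)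
    (hz : ∀ w : W, τ.zeroTwo ((mu k n).restrict (subgroupIncl (galFixing k E))) ι w (hτ · w) z = 0) :
    z = 0 :=
  ContinuousRep.zeroTwo_eq_zero_of_torsionIncl_injective τ _ ι hι
    (cohomologyMap_torsionIncl_mu_injective k (galFixing k E) hpn hp.out.pos
      (subsingleton_one_units_galFixing E)) hτ hW z hz

end GalFixing

end Literature.NumberTheory.GaloisRepresentations

end
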